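import Summits.QuantumFields.YangMills.Theorems.LuscherReductionRunningReductionLatticeLinkKernel
import Literature.Analysis.OperatorTheory.GaussianTransferKernelFrame
import Mathlib.Analysis.InnerProductSpace.Positive
import HarnessLib

/-!
# The STIFF HESSIAN of the `L³` torus: the lattice curl `d` on colour-vector 1-forms, `H = d†d` (positive, kernel ⊇ pure gauges ⊕ constant
# modes), and the Gaussian ground state of the harmonic transfer kernel with Hessian `H` by normal modes
# (brick for the adiabatic stiff Gaussian of both COARSE lanes; lane B of S-BASE, crux `TwistedTraceScaling` stmt-QuantumFields-20203)

Near the vacuum, in tangent (colour-vector) link coordinates `v : Edge × Fin 3 → ℝ`, the magnetic term of the transfer kernel is the squared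
LATTICE CURL `½Σ_p ‖(dF)_p‖²` up to a cubic remainder (`Theorems/…MagneticQuadratic.lean`), and the kinetic term is an exact Gaussian
(`Theorems/…ElectricSplit.lean`).  This module types the quadratic (harmonic) model on the real inner-product space
`LinkSpace L = EuclideanSpace ℝ (Edge 3 L × Fin 3)`:

* `latCurl L : LinkSpace L →ₗ[ℝ] PlaqSpace L`, `(dv)(x;i<j;a) = v(x,i;a) + v(x+eᵢ,j;a) − v(x+eⱼ,i;a) − v(x,j;a)` (`latCurl_apply`);
* `stiffHessian L = (latCurl L)† ∘ latCurl L` — ★ `stiffHessian_isPositive`, `inner_stiffHessian : ⟪v, Hv⟫ = ‖dv‖²`,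
  `norm_latCurl_sq` (the sum of squares), hence non-negative eigenvalues (`stiffHessian_nonneg_eigenvalues`);
* its zero modes: ★ `latCurl_constMode` (direction-constant 1-forms: the 9 zero modes of Lüscher's `𝔥`) and ★ `latCurl_gradient` (pure gauges
  `v(x,i) = φ(x+eᵢ) − φ(x)`: linearised gauge modes) lie in `ker d = ker H`;
* ★ `stiff_groundState` / `stiff_formBound`: for `t ≥ 0`, `b > 0` the harmonic transfer kernel `e^{−t⟪x,Hx⟫}e^{−b‖x−y‖²}e^{−t⟪y,Hy⟫}` has the
  normal-mode Gaussian ground state and eigenvalue `Πᵢ √(π/(taᵢ + b + cᵢ))`, `aᵢ` the eigenvalues of `H`, `cᵢ² = (taᵢ)² + 2taᵢb`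
  (tree `Literature.…GaussianTransferKernelFrame`, p531681) — free factor `√(π/b)` on every zero mode.

HONEST FRAMING: linear algebra of the quadratic model only (no chart, no sphere, no cubic terms); femto rung R2b1 (stub of a child of a
CONDITIONAL route); not a gap, not Clay.
-/

set_option autoImplicit false

noncomputable section

open MeasureTheory Real
open scoped BigOperators RealInnerProductSpace
open Literature.MathematicalPhysics.QuantumFieldTheory
open Literature.MathematicalPhysics.QuantumLattice

namespace Summit.QuantumFields.YangMills.Theorems.FemtoTransferGap.TwoLattice.Stiff

variable (L : ℕ) [NeZero L]

/-! ## §1 The spaces and the lattice curl -/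

/-- Colour-vector-valued 1-forms on the torus: `v(e; a)`, `e` a positively oriented link, `a ∈ Fin 3` a colour index, with the Euclidean
inner product. [cite: Luscher1983, §3] -/
abbrev LinkSpace : Type := EuclideanSpace ℝ (Edge 3 L × Fin 3)

/-- Colour-vector-valued 2-forms (plaquette functions). [cite: Luscher1983, §3] -/
abbrev PlaqSpace : Type := EuclideanSpace ℝ (Plaquette 3 L × Fin 3)

/-- The four links of the plaquette `(x; i<j)` with signs `+ + − −`: `(x,i)`, `(x+eᵢ,j)`, `(x+eⱼ,i)`, `(x,j)` — the raw lattice curl on functions.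
[cite: Wilson1974] -/
def curlFun : (Edge 3 L × Fin 3 → ℝ) →ₗ[ℝ] (Plaquette 3 L × Fin 3 → ℝ) where
  toFun v q := v ((q.1.1, q.1.2.1.1), q.2) + v ((q.1.1.shift q.1.2.1.1, q.1.2.1.2), q.2)
    - v ((q.1.1.shift q.1.2.1.2, q.1.2.1.1), q.2) - v ((q.1.1, q.1.2.1.2), q.2)
  map_add' v w := by funext q; simp only [Pi.add_apply]; ring
  map_smul' r v := by funext q; simp only [Pi.smul_apply, smul_eq_mul, RingHom.id_apply]; ring

/-- **The lattice curl** `d : LinkSpace → PlaqSpace` (linearised plaquette holonomy, colour by colour). [cite: Wilson1974] [cite: Luscher1983, §3] -/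
def latCurl : LinkSpace L →ₗ[ℝ] PlaqSpace L :=
  (WithLp.linearEquiv 2 ℝ (Plaquette 3 L × Fin 3 → ℝ)).symm.toLinearMap ∘ₗ curlFun L ∘ₗ
    (WithLp.linearEquiv 2 ℝ (Edge 3 L × Fin 3 → ℝ)).toLinearMap

omit [NeZero L] in
/-- Components of the lattice curl. [cite: Wilson1974] -/
theorem latCurl_apply (v : LinkSpace L) (x : Site 3 L) (ij : {p : Fin 3 × Fin 3 // p.1 < p.2}) (a : Fin 3) :
    latCurl L v ((x, ij), a) =
      v ((x, ij.1.1), a) + v ((x.shift ij.1.1, ij.1.2), a) - v ((x.shift ij.1.2, ij.1.1), a) - v ((x, ij.1.2), a) := by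
  simp [latCurl, curlFun]

/-! ## §2 The stiff Hessian `H = d†d` -/

/-- **The stiff Hessian** `H = d† ∘ d` on `LinkSpace L` (the Hessian of `½Σ_p‖(dv)_p‖²`). [cite: Luscher1983, §3] [cite: Wipf2021, §8.5.2] -/
def stiffHessian : LinkSpace L →ₗ[ℝ] LinkSpace L := (latCurl L).adjoint ∘ₗ latCurl L

/-- ★ `H = d†d` is a positive operator. [cite: Wipf2021, §8.5.2] -/
theorem stiffHessian_isPositive : (stiffHessian L).IsPositive := LinearMap.isPositive_adjoint_comp_self _

/-- `H` is symmetric. [cite: Wipf2021, §8.5.2] -/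
theorem stiffHessian_isSymmetric : (stiffHessian L).IsSymmetric := (stiffHessian_isPositive L).isSymmetric

/-- ★ The quadratic form of `H` is the squared curl: `⟪v, Hv⟫ = ‖dv‖²`. [cite: Wipf2021, §8.5.2] -/
theorem inner_stiffHessian (v : LinkSpace L) : ⟪v, stiffHessian L v⟫ = ‖latCurl L v‖ ^ 2 := by
  unfold stiffHessian
  rw [LinearMap.comp_apply, LinearMap.adjoint_inner_right, real_inner_self_eq_norm_sq]

/-- `‖dv‖² = Σ_{x, i<j, a} (dv)(x; i<j; a)²`. [folklore] -/
theorem norm_latCurl_sq (v : LinkSpace L) :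
    ‖latCurl L v‖ ^ 2 = ∑ q : Plaquette 3 L × Fin 3, (latCurl L v q) ^ 2 := by
  rw [EuclideanSpace.norm_sq_eq]
  simp only [Real.norm_eq_abs, sq_abs]

/-- The eigenvalues of `H` (any eigen-enumeration) are non-negative. [cite: Wipf2021, §8.5.2] -/
theorem stiffHessian_nonneg_eigenvalues {n : ℕ} (hn : Module.finrank ℝ (LinkSpace L) = n) (i : Fin n) :
    0 ≤ (stiffHessian_isPositive L).isSymmetric.eigenvalues hn i :=
  (stiffHessian_isPositive L).nonneg_eigenvalues hn i

/-! ## §3 Zero modes: constant 1-forms and pure gauges -/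

omit [NeZero L] in
/-- Shifts in different directions commute: `(x + eᵢ) + eⱼ = (x + eⱼ) + eᵢ`. [folklore] -/
theorem shift_shift_comm (x : Site 3 L) (i j : Fin 3) : (x.shift i).shift j = (x.shift j).shift i := by
  simp only [Site.shift]; abel

omit [NeZero L] in
/-- ★ **Direction-constant 1-forms are zero modes of the curl** (`v(x,i;a) = c(i,a)`): the nine zero modes carrying Lüscher's `𝔥`.
[cite: Luscher1983, §3] -/
theorem latCurl_constMode (c : Fin 3 → Fin 3 → ℝ) :
    latCurl L (WithLp.toLp 2 fun ea : Edge 3 L × Fin 3 => c ea.1.2 ea.2) = 0 := by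
  ext q
  obtain ⟨⟨x, ij⟩, a⟩ := q
  rw [latCurl_apply]
  simp

omit [NeZero L] in
/-- ★ **Pure gauges are zero modes of the curl** (`v(x,i;a) = φ(x+eᵢ;a) − φ(x;a)`, the linearised gauge modes). [cite: Wilson1974] [cite: Luscher1983, §3] -/
theorem latCurl_gradient (φ : Site 3 L → Fin 3 → ℝ) :
    latCurl L (WithLp.toLp 2 fun ea : Edge 3 L × Fin 3 => φ (ea.1.1.shift ea.1.2) ea.2 - φ ea.1.1 ea.2) = 0 := by
  ext q
  obtain ⟨⟨x, ij⟩, a⟩ := q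
  rw [latCurl_apply]
  simp only [PiLp.zero_apply, shift_shift_comm L x ij.1.1 ij.1.2]
  ring

/-- Zero modes of the curl are zero modes of `H`. [folklore] -/
theorem stiffHessian_eq_zero_of_latCurl {v : LinkSpace L} (hv : latCurl L v = 0) : stiffHessian L v = 0 := by
  unfold stiffHessian; rw [LinearMap.comp_apply, hv, map_zero]

/-! ## §4 The harmonic transfer kernel with Hessian `H`: Gaussian ground state by normal modes -/

/-- `t • H` is positive for `t ≥ 0`. [folklore] -/
theorem isPositive_smul_stiffHessian {t : ℝ} (ht : 0 ≤ t) : (t • stiffHessian L).IsPositive := by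
  refine ⟨(stiffHessian_isSymmetric L).smul (by simp), fun v => ?_⟩
  have h : ⟪(t • stiffHessian L) v, v⟫ = t * ‖latCurl L v‖ ^ 2 := by
    rw [LinearMap.smul_apply, real_inner_smul_left, real_inner_comm, inner_stiffHessian]
  rw [h]
  simp only [RCLike.re_to_real]
  positivity

/-- ★ **THE STIFF GAUSSIAN GROUND STATE.**  For `t ≥ 0`, `b > 0`: with `eᵢ, aᵢ` an eigenframe of `t·H` (eigenvalues `aᵢ ≥ 0`) and
`cᵢ ≥ 0`, `cᵢ² = aᵢ² + 2aᵢb`, the harmonic transfer kernel `e^{−⟪x,tHx⟫} e^{−b‖x−y‖²} e^{−⟪y,tHy⟫}` on `LinkSpace L` reproduces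
`h(x) = e^{−Σcᵢ⟪eᵢ,x⟫²}` with the factor `Πᵢ √(π/(aᵢ + b + cᵢ))` — every zero mode (`aᵢ = 0`: pure gauges, constant modes) contributes the free
factor `√(π/b)`. [cite: Wipf2021, §8.5.1 (8.56)–(8.57)] [cite: Wipf2021, §8.5.2 (8.64)–(8.67)] -/
theorem stiff_groundState {t : ℝ} (ht : 0 ≤ t) {n : ℕ} (hn : Module.finrank ℝ (LinkSpace L) = n) {b : ℝ} (hb : 0 < b)
    {c : Fin n → ℝ} (hc0 : ∀ i, 0 ≤ c i)
    (hc : ∀ i, c i ^ 2 = (isPositive_smul_stiffHessian L ht).isSymmetric.eigenvalues hn i ^ 2 +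
      2 * (isPositive_smul_stiffHessian L ht).isSymmetric.eigenvalues hn i * b) (x : LinkSpace L) :
    ∫ y, Real.exp (-⟪x, (t • stiffHessian L) x⟫) * Real.exp (-(b * ‖x - y‖ ^ 2)) * Real.exp (-⟪y, (t • stiffHessian L) y⟫) *
        Real.exp (-(∑ i, c i * ⟪(isPositive_smul_stiffHessian L ht).isSymmetric.eigenvectorBasis hn i, y⟫ ^ 2)) =
      (∏ i, Real.sqrt (π / ((isPositive_smul_stiffHessian L ht).isSymmetric.eigenvalues hn i + b + c i))) *
        Real.exp (-(∑ i, c i * ⟪(isPositive_smul_stiffHessian L ht).isSymmetric.eigenvectorBasis hn i, x⟫ ^ 2)) :=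
  Literature.Analysis.OperatorTheory.GaussianTransferKernel.integral_gaussKernel_mul_groundState_symm
    (isPositive_smul_stiffHessian L ht).isSymmetric hn ((isPositive_smul_stiffHessian L ht).nonneg_eigenvalues hn) hb hc0 hc x

/-- ★ **THE STIFF FORM BOUND** (top of the spectrum of the harmonic stiff transfer operator = product of normal-mode eigenvalues):
`∫∫ f(x) e^{−⟪x,tHx⟫} e^{−b‖x−y‖²} e^{−⟪y,tHy⟫} f(y) ≤ (Πᵢ √(π/(aᵢ + b + cᵢ))) ∫ f²`. [cite: Wipf2021, §8.5.1 (8.56)–(8.58)] -/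
theorem stiff_formBound {t : ℝ} (ht : 0 ≤ t) {n : ℕ} (hn : Module.finrank ℝ (LinkSpace L) = n) {b : ℝ} (hb : 0 < b)
    {c : Fin n → ℝ} (hc0 : ∀ i, 0 ≤ c i)
    (hc : ∀ i, c i ^ 2 = (isPositive_smul_stiffHessian L ht).isSymmetric.eigenvalues hn i ^ 2 +
      2 * (isPositive_smul_stiffHessian L ht).isSymmetric.eigenvalues hn i * b)
    {f : LinkSpace L → ℝ} (hf : Integrable (fun x => f x ^ 2)) (hfm : AEStronglyMeasurable f volume) :
    ∫ x, ∫ y, f x * (Real.exp (-⟪x, (t • stiffHessian L) x⟫) * Real.exp (-(b * ‖x - y‖ ^ 2)) *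
        Real.exp (-⟪y, (t • stiffHessian L) y⟫)) * f y ≤
      (∏ i, Real.sqrt (π / ((isPositive_smul_stiffHessian L ht).isSymmetric.eigenvalues hn i + b + c i))) * ∫ x, f x ^ 2 :=
  Literature.Analysis.OperatorTheory.GaussianTransferKernel.integral_integral_mul_gaussKernel_mul_self_le_symm
    (isPositive_smul_stiffHessian L ht).isSymmetric hn ((isPositive_smul_stiffHessian L ht).nonneg_eigenvalues hn) hb hc0 hc hf hfm

end Summit.QuantumFields.YangMills.Theorems.FemtoTransferGap.TwoLattice.Stiff

end
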